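/-
Copyright (c) 2026. All rights reserved.
Released under Apache 2.0 license as described in the file LICENSE.
Authors: abc-iut cell, statement-typer seat abc-iut-L4-t3 (wave 1).
-/
import Literature.AnabelianGeometry.AbsoluteAnabelian.LogFrobeniusTelecoreShift

/-!
# [AbsTopIII] Corollary 5.5 (v), last sentence: the shifts of `D_{An•}` are COMPATIBLE with `𝔍` and `ℋ_{An•}` — invariance of
# the universal family

S. Mochizuki, *Topics in absolute anabelian geometry III: global reconstruction algorithms*,
J. Math. Sci. Univ. Tokyo 22 (2015) 939–1156 [MochizukiAbsTopIII2015]; Cor 5.5 (v), last sentence, p. 132.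

Continuation of `LogFrobeniusTelecoreShift.lean` (the shift self-equivalences `telShiftSelfEquivalence k` of the telecore
diagram `D_{An•}`). Here: the structure functors of `D_{An•}` over `𝒳` (`contactOver`, `LogFrobeniusContactStructure.lean`)
are INVARIANT under the shifts (`telShift_N_obj`, `telShift_μ_app_heq`), hence so are the isomorphisms `pathIso`
(`telShift_pathIso_app_heq`), the lifts through the fully faithful vertices `An•[𝒳]`, `□`, `𝒳_⋎`
(`telShift_lift_app_eq`) and the homotopies of the universal family `K` (`telShift_univ_η_heq`) — the invariance of
abc-iut-L4-t5's universal-family construction under a structure-preserving self-equivalence, worked out for the shifts.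
The Def 3.5 (v) compatibility of the shifts with the telecore family `𝔍` and the contact structure `ℋ_{An•}` and the
theorem `cor55ShiftActionTelecore_holds` are assembled in `LogFrobeniusTelecoreShiftHolds.lean`. Pure category theory
over the interface `L`; refereed pre-IUT material; nothing here bears on [IUTchIII] Cor. 3.12.
-/

set_option autoImplicit false

universe u

open CategoryTheory Quiver

namespace Literature.AnabelianGeometry.AbsoluteAnabelian

namespace LogFrobeniusSetting

open DiagramOfCategories

variable {Vmod : Type u} {isArc : Vmod → Bool} (L : LogFrobeniusSetting Vmod isArc)

/-! ## Bookkeeping under `≍` -/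

section HEqTools

variable {C : Type (u + 1)} [Category.{u} C] {C' : Type (u + 1)} [Category.{u} C']

/-- `eqToHom`s between pairwise equal objects are heterogeneously equal. [folklore] -/
private theorem heq_eqToHom_eqToHom {X Y X' Y' : C} (h : X = Y) (h' : X' = Y') (e : X = X') :
    HEq (eqToHom h) (eqToHom h') := by
  subst e; subst h; subst h'; rfl

/-- components of a natural transformation at equal objects are heterogeneously equal. [folklore] -/
private theorem natTrans_app_heq {A : Type (u + 1)} [Category.{u} A] {F G : A ⥤ C} (α : F ⟶ G) {y y' : A} (hy : y = y') :
    HEq (α.app y) (α.app y') := by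
  subst hy; rfl

/-- components of heterogeneously equal natural transformations (between equal functors) are heterogeneously equal.
[folklore] -/
private theorem natTrans_app_heq' {A : Type (u + 1)} [Category.{u} A] {F G F' G' : A ⥤ C} (hF : F = F') (hG : G = G')
    {α : F ⟶ G} {α' : F' ⟶ G'} (h : HEq α α') (y : A) : HEq (α.app y) (α'.app y) := by
  subst hF hG; cases h; rfl

/-- a functor maps heterogeneously equal morphisms to heterogeneously equal morphisms. [folklore] -/
private theorem functor_map_heq (G : C ⥤ C') {A B A' B' : C} (hA : A = A') (hB : B = B') {f : A ⟶ B} {f' : A' ⟶ B'}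
    (h : HEq f f') : HEq (G.map f) (G.map f') := by
  subst hA hB; cases h; rfl

/-- the `hom` parts of heterogeneously equal isomorphisms (between equal functors) are heterogeneously equal. [folklore] -/
private theorem iso_hom_heq {A : Type (u + 1)} [Category.{u} A] {F G F' G' : A ⥤ C} (hF : F = F') (hG : G = G')
    {i : F ≅ G} {i' : F' ≅ G'} (h : HEq i i') : HEq i.hom i'.hom := by
  subst hF hG; cases h; rfl

/-- the inverses of heterogeneously equal isomorphisms (between equal objects) are heterogeneously equal. [folklore] -/
private theorem iso_inv_heq' {X Y X' Y' : C} (i : X ≅ Y) (i' : X' ≅ Y') (hX : X = X') (hY : Y = Y')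
    (h : HEq i.hom i'.hom) : HEq i.inv i'.inv := by
  subst hX hY
  obtain rfl : i = i' := Iso.ext (eq_of_heq h)
  rfl

/-- cancelling a faithful functor under `≍`. [folklore] -/
private theorem heq_of_map_heq (G : C ⥤ C') (hG : G.FullyFaithful) {A B A' B' : C} (hA : A = A') (hB : B = B')
    {f : A ⟶ B} {f' : A' ⟶ B'} (h : HEq (G.map f) (G.map f')) : HEq f f' := by
  subst hA hB
  exact heq_of_eq (hG.map_injective (eq_of_heq h))

end HEqTools

/-! ## The structure functors over `𝒳` are invariant under the shifts -/

/-- transporting an arrow along equalities of its end-vertices does not change its structure isomorphism. [folklore] -/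
private theorem holOverXIso_cast_heq {a a' b b' : DVertex Vmod isArc} (ha : a = a') (hb : b = b') (e : a ⟶ b)
    (h₁ : a.IsHolomorphic) (h₂ : b.IsHolomorphic) (h₁' : a'.IsHolomorphic) (h₂' : b'.IsHolomorphic) :
    HEq (L.holOverXIso (e.cast ha hb) h₁' h₂') (L.holOverXIso e h₁ h₂) := by
  subst ha hb; rfl

/-- the structure functors are invariant under the shift, on objects: `N_{w+k}(Φ_w y) = N_w(y)`.
[cite: MochizukiAbsTopIII2015, Cor 5.5 (v) p. 132] -/
theorem telShift_N_obj (k : ℤ) (w : (anTelecoreShape (Vmod := Vmod) (isArc := isArc) anTelJ).Vertex)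
    (y : (L.anTelecoreDiagram anTelJ (fun {a} j => L.telecoreFun a.1 j)).obj w) :
    ((L.contactOver).N (telShiftObj k w)).obj ((L.telShiftApp k w).obj y) = ((L.contactOver).N w).obj y := by
  cases w with
  | obs => rfl
  | base a =>
    obtain ⟨x, hx⟩ := a
    cases x <;> rfl

/-- the structure functors are invariant under the shift, on morphisms (heterogeneously). [cite: MochizukiAbsTopIII2015, Cor 5.5 (v) p. 132] -/
theorem telShift_N_map_heq (k : ℤ) (w : (anTelecoreShape (Vmod := Vmod) (isArc := isArc) anTelJ).Vertex)
    {y y' : (L.anTelecoreDiagram anTelJ (fun {a} j => L.telecoreFun a.1 j)).obj w} (f : y ⟶ y') :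
    HEq (((L.contactOver).N (telShiftObj k w)).map ((L.telShiftApp k w).map f)) (((L.contactOver).N w).map f) := by
  cases w with
  | obs => rfl
  | base a =>
    obtain ⟨x, hx⟩ := a
    cases x <;> rfl

/-- the vertex functors of the shift act trivially on morphisms (heterogeneously): `Φ_w(f) ≍ f`. [cite: MochizukiAbsTopIII2015, Cor 5.5 (v) p. 132] -/
theorem telShiftApp_map_heq (k : ℤ) (w : (anTelecoreShape (Vmod := Vmod) (isArc := isArc) anTelJ).Vertex)
    {y y' : (L.anTelecoreDiagram anTelJ (fun {a} j => L.telecoreFun a.1 j)).obj w} (f : y ⟶ y') :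
    HEq ((L.telShiftApp k w).map f) f := by
  cases w with
  | obs => rfl
  | base a =>
    obtain ⟨x, hx⟩ := a
    cases x <;> rfl

/-- the `log` case of `telShift_μ_app_heq`: the shifted `log` arrow is a transported `log` arrow realising `log`. [folklore] -/
private theorem telShift_μ_app_heq_log (k n : ℤ) (hx : InFive (isArc := isArc) (.row1 (n + 1)))
    (hx' : InFive (isArc := isArc) (.row1 n)) (y : L.X) :
    HEq (((L.contactOver).μ (telShiftMap k
        (show (anTelecoreShape (isArc := isArc) anTelJ).base ⟨.row1 (n + 1), hx⟩ ⟶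
          (anTelecoreShape anTelJ).base ⟨.row1 n, hx'⟩ from DEdge.log n))).hom.app
        ((L.telShiftApp k ((anTelecoreShape (isArc := isArc) anTelJ).base ⟨.row1 (n + 1), hx⟩)).obj y))
      (((L.contactOver).μ
        (show (anTelecoreShape (isArc := isArc) anTelJ).base ⟨.row1 (n + 1), hx⟩ ⟶
          (anTelecoreShape anTelJ).base ⟨.row1 n, hx'⟩ from DEdge.log n)).hom.app y) := by
  have hμ : HEq ((L.contactOver).μ (telShiftMap k
      (show (anTelecoreShape (isArc := isArc) anTelJ).base ⟨.row1 (n + 1), hx⟩ ⟶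
        (anTelecoreShape anTelJ).base ⟨.row1 n, hx'⟩ from DEdge.log n)))
      ((L.contactOver).μ
        (show (anTelecoreShape (isArc := isArc) anTelJ).base ⟨.row1 (n + 1), hx⟩ ⟶
          (anTelecoreShape anTelJ).base ⟨.row1 n, hx'⟩ from DEdge.log n)) :=
    L.holOverXIso_cast_heq (congrArg DVertex.row1 (Int.add_right_comm n k 1)) rfl
      (DEdge.log (isArc := isArc) (n + k)) trivial trivial trivial trivial
  have hF : DEdge.functor L (DVertex.shiftHom k (DEdge.log (isArc := isArc) n)) ⋙ 𝟭 L.X = L.log ⋙ 𝟭 L.X :=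
    congrArg (· ⋙ 𝟭 L.X) (L.functor_shiftHom_log k n)
  exact natTrans_app_heq' hF rfl (iso_hom_heq hF rfl hμ) y

/-- the structure isomorphisms `μ` are invariant under the shift, componentwise (heterogeneously).
[cite: MochizukiAbsTopIII2015, Cor 5.5 (v) p. 132] -/
theorem telShift_μ_app_heq (k : ℤ) {b c : (anTelecoreShape (Vmod := Vmod) (isArc := isArc) anTelJ).Vertex} (e : b ⟶ c)
    (y : (L.anTelecoreDiagram anTelJ (fun {a} j => L.telecoreFun a.1 j)).obj b) :
    HEq (((L.contactOver).μ (telShiftMap k e)).hom.app ((L.telShiftApp k b).obj y)) (((L.contactOver).μ e).hom.app y) := by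
  cases b with
  | obs =>
    cases c with
    | obs => exact PEmpty.elim e
    | base c =>
      obtain ⟨x, hx⟩ := c
      cases x <;> first | rfl | exact PEmpty.elim e
  | base b =>
    obtain ⟨x, hx⟩ := b
    cases c with
    | obs =>
      cases e
      rfl
    | base c =>
      obtain ⟨x', hx'⟩ := c
      cases e
      case log n => exact L.telShift_μ_app_heq_log k n _ _ y
      all_goals rfl

/-! ## The shift commutes with the path functors; `pathIso` and the lifts are invariant -/

/-- the shift commutes (strictly) with the functors of `D_{An•}`, arrows taken through `telShiftGraph`. [cite: MochizukiAbsTopIII2015, Cor 5.5 (v) p. 132] -/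
theorem telShift_comm' (k : ℤ) {a b : (anTelecoreShape (Vmod := Vmod) (isArc := isArc) anTelJ).Vertex} (e : a ⟶ b) :
    L.telShiftApp k a ⋙ (L.anTelecoreDiagram anTelJ (fun {a} j => L.telecoreFun a.1 j)).map ((telShiftGraph k).map e) =
      (L.anTelecoreDiagram anTelJ (fun {a} j => L.telecoreFun a.1 j)).map e ⋙ L.telShiftApp k b :=
  L.telShift_comm k e

/-- the shift commutes (strictly) with the path functors of `D_{An•}`: `Φ_a ⋙ 𝒟_[Φγ] = 𝒟_[γ] ⋙ Φ_b`.
[cite: MochizukiAbsTopIII2015, Cor 5.5 (v) p. 132] -/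
theorem telShift_pathComm (k : ℤ) {a b : (anTelecoreShape (Vmod := Vmod) (isArc := isArc) anTelJ).Vertex} (p : Path a b) :
    L.telShiftApp k a ⋙ (L.anTelecoreDiagram anTelJ (fun {a} j => L.telecoreFun a.1 j)).pathFunctor
        ((telShiftGraph k).mapPath p) =
      (L.anTelecoreDiagram anTelJ (fun {a} j => L.telecoreFun a.1 j)).pathFunctor p ⋙ L.telShiftApp k b := by
  induction p with
  | nil =>
    erw [Prefunctor.mapPath_nil, pathFunctor_nil, pathFunctor_nil]
    rfl
  | cons p e ih =>
    erw [Prefunctor.mapPath_cons, pathFunctor_cons, pathFunctor_cons, ← Functor.assoc, ih, Functor.assoc,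
      L.telShift_comm' k e, ← Functor.assoc]

/-- objects along shifted paths: `𝒟_[Φγ](Φ_a x) = Φ_b(𝒟_[γ] x)`. [cite: MochizukiAbsTopIII2015, Cor 5.5 (v) p. 132] -/
theorem telShift_pathFunctor_obj (k : ℤ) {a b : (anTelecoreShape (Vmod := Vmod) (isArc := isArc) anTelJ).Vertex}
    (p : Path a b) (x : (L.anTelecoreDiagram anTelJ (fun {a} j => L.telecoreFun a.1 j)).obj a) :
    ((L.anTelecoreDiagram anTelJ (fun {a} j => L.telecoreFun a.1 j)).pathFunctor ((telShiftGraph k).mapPath p)).obj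
        ((L.telShiftApp k a).obj x) =
      (L.telShiftApp k b).obj (((L.anTelecoreDiagram anTelJ (fun {a} j => L.telecoreFun a.1 j)).pathFunctor p).obj x) :=
  Functor.congr_obj (L.telShift_pathComm k p) x

/-- **`pathIso` is invariant under the shift**, componentwise (heterogeneously): `pathIso (Φγ)` at `Φ_a x` is `pathIso γ`
at `x`. [cite: MochizukiAbsTopIII2015, Cor 5.5 (v) p. 132] -/
theorem telShift_pathIso_app_heq (k : ℤ) {a b : (anTelecoreShape (Vmod := Vmod) (isArc := isArc) anTelJ).Vertex}
    (p : Path a b) (x : (L.anTelecoreDiagram anTelJ (fun {a} j => L.telecoreFun a.1 j)).obj a) :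
    HEq (((L.contactOver).pathIso ((telShiftGraph k).mapPath p)).hom.app ((L.telShiftApp k a).obj x))
      (((L.contactOver).pathIso p).hom.app x) := by
  induction p with
  | nil =>
    rw [Prefunctor.mapPath_nil]
    erw [OverData.pathIso_nil_app, OverData.pathIso_nil_app]
    refine heq_eqToHom_eqToHom _ _ ?_
    show ((L.contactOver).N (telShiftObj k a)).obj
        (((L.anTelecoreDiagram anTelJ (fun {a} j => L.telecoreFun a.1 j)).pathFunctor Path.nil).obj
          ((L.telShiftApp k a).obj x)) =
      ((L.contactOver).N a).obj (((L.anTelecoreDiagram anTelJ (fun {a} j => L.telecoreFun a.1 j)).pathFunctor Path.nil).obj x)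
    erw [pathFunctor_nil, pathFunctor_nil]
    exact L.telShift_N_obj k a x
  | cons p e ih =>
    rename_i b c
    have hy := L.telShift_pathFunctor_obj k p x
    have he := Functor.congr_obj (L.telShift_comm' k e)
      (((L.anTelecoreDiagram anTelJ (fun {a} j => L.telecoreFun a.1 j)).pathFunctor p).obj x)
    have o₄ : ((L.contactOver).N (telShiftObj k a)).obj ((L.telShiftApp k a).obj x) = ((L.contactOver).N a).obj x :=
      L.telShift_N_obj k a x
    have o₃ : ((L.contactOver).N (telShiftObj k b)).obj
        (((L.anTelecoreDiagram anTelJ (fun {a} j => L.telecoreFun a.1 j)).pathFunctor ((telShiftGraph k).mapPath p)).obj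
          ((L.telShiftApp k a).obj x)) =
        ((L.contactOver).N b).obj (((L.anTelecoreDiagram anTelJ (fun {a} j => L.telecoreFun a.1 j)).pathFunctor p).obj x) := by
      rw [hy]; exact L.telShift_N_obj k b _
    have o₂ : ((L.contactOver).N (telShiftObj k c)).obj
        (((L.anTelecoreDiagram anTelJ (fun {a} j => L.telecoreFun a.1 j)).map ((telShiftGraph k).map e)).obj
          (((L.anTelecoreDiagram anTelJ (fun {a} j => L.telecoreFun a.1 j)).pathFunctor ((telShiftGraph k).mapPath p)).obj
            ((L.telShiftApp k a).obj x))) =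
        ((L.contactOver).N c).obj (((L.anTelecoreDiagram anTelJ (fun {a} j => L.telecoreFun a.1 j)).map e).obj
          (((L.anTelecoreDiagram anTelJ (fun {a} j => L.telecoreFun a.1 j)).pathFunctor p).obj x)) := by
      rw [hy]
      erw [he]
      exact L.telShift_N_obj k c _
    have o₁ : ((L.contactOver).N (telShiftObj k c)).obj
        (((L.anTelecoreDiagram anTelJ (fun {a} j => L.telecoreFun a.1 j)).pathFunctor
          (((telShiftGraph k).mapPath p).cons ((telShiftGraph k).map e))).obj ((L.telShiftApp k a).obj x)) =
        ((L.contactOver).N c).obj (((L.anTelecoreDiagram anTelJ (fun {a} j => L.telecoreFun a.1 j)).pathFunctor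
          (p.cons e)).obj x) := by
      erw [pathFunctor_cons, pathFunctor_cons]; exact o₂
    rw [Prefunctor.mapPath_cons]
    erw [OverData.pathIso_cons_app, OverData.pathIso_cons_app]
    refine heq_comp o₁ o₂ o₄ (heq_eqToHom_eqToHom _ _ o₁) (heq_comp o₂ o₃ o₄ ?_ ih)
    exact (natTrans_app_heq _ hy).trans (L.telShift_μ_app_heq k e _)

/-- **the lifts are invariant under the shift** (through the fully faithful vertices `An•[𝒳]`, `□`, `𝒳_⋎` and their shifts):
the lift of `(Φγ₁, Φγ₂)` at `Φ_a x` is `Φ_w` applied to the lift of `(γ₁, γ₂)` at `x`, up to the object identities of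
`telShift_pathFunctor_obj`. [cite: MochizukiAbsTopIII2015, Cor 5.5 (v) p. 132] -/
theorem telShift_lift_app_heq (k : ℤ) {a w : (anTelecoreShape (Vmod := Vmod) (isArc := isArc) anTelJ).Vertex}
    (hw : contactW w) (hw' : contactW (telShiftObj k w)) (p q : Path a w)
    (x : (L.anTelecoreDiagram anTelJ (fun {a} j => L.telecoreFun a.1 j)).obj a) :
    HEq (((L.contactOver).lift (L.contactFF _ hw') ((telShiftGraph k).mapPath p) ((telShiftGraph k).mapPath q)).app
        ((L.telShiftApp k a).obj x))
      ((L.telShiftApp k w).map (((L.contactOver).lift (L.contactFF w hw) p q).app x)) := by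
  refine heq_of_map_heq ((L.contactOver).N (telShiftObj k w)) (L.contactFF _ hw')
    (L.telShift_pathFunctor_obj k p x) (L.telShift_pathFunctor_obj k q x) ?_
  erw [OverData.map_lift_app]
  refine HEq.trans ?_ (L.telShift_N_map_heq k w _).symm
  erw [OverData.map_lift_app]
  have o₁ := L.telShift_pathFunctor_obj k p x
  have o₂ := L.telShift_pathFunctor_obj k q x
  refine heq_comp ?_ (L.telShift_N_obj k a x) ?_ (L.telShift_pathIso_app_heq k p x)
    (iso_inv_heq' (((L.contactOver).pathIso ((telShiftGraph k).mapPath q)).app ((L.telShiftApp k a).obj x))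
      (((L.contactOver).pathIso q).app x) ?_ (L.telShift_N_obj k a x) (L.telShift_pathIso_app_heq k q x))
  · exact (congrArg ((L.contactOver).N (telShiftObj k w)).obj o₁).trans (L.telShift_N_obj k w _)
  · exact (congrArg ((L.contactOver).N (telShiftObj k w)).obj o₂).trans (L.telShift_N_obj k w _)
  · exact (congrArg ((L.contactOver).N (telShiftObj k w)).obj o₂).trans (L.telShift_N_obj k w _)

/-! ## The universal family `K` of `D_{An•}` is invariant under the shifts -/

/-- the fully faithful vertex set `{An•[𝒳], □, 𝒳_⋎}` is stable under the shifts. [cite: MochizukiAbsTopIII2015, Cor 5.5 (v) p. 132] -/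
theorem contactW_shift (k : ℤ) {w : (anTelecoreShape (Vmod := Vmod) (isArc := isArc) anTelJ).Vertex} (hw : contactW w) :
    contactW (telShiftObj k w) := by
  cases w with
  | obs => trivial
  | base a =>
    obtain ⟨x, hx⟩ := a
    cases x <;> trivial

/-- shifting a decomposition through `W`. [cite: MochizukiAbsTopIII2015, Cor 5.5 (v) p. 132] -/
def Decomp.telShift (k : ℤ) {a b : (anTelecoreShape (Vmod := Vmod) (isArc := isArc) anTelJ).Vertex} {p q : Path a b}
    (d : Decomp contactW p q) : Decomp contactW ((telShiftGraph k).mapPath p) ((telShiftGraph k).mapPath q) where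
  w := (telShiftGraph k).obj d.w
  mem := contactW_shift k d.mem
  p := (telShiftGraph k).mapPath d.p
  q := (telShiftGraph k).mapPath d.q
  s := (telShiftGraph k).mapPath d.s
  left_eq := by
    have h := congrArg (telShiftGraph (isArc := isArc) k).mapPath d.left_eq
    rw [Prefunctor.mapPath_comp] at h
    exact h
  right_eq := by
    have h := congrArg (telShiftGraph (isArc := isArc) k).mapPath d.right_eq
    rw [Prefunctor.mapPath_comp] at h
    exact h

/-- **the universal family is invariant under the shifts**: the homotopy of `K` on a shifted pair, at `Φ_a x`, is `Φ_b`
applied to the homotopy on the pair at `x` (heterogeneously — the whiskered lifts of abc-iut-L4-t5's `Decomp.η` commute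
with the identity functors of the shift). [cite: MochizukiAbsTopIII2015, Cor 5.5 (v) p. 132] -/
theorem telShift_univ_η_heq (k : ℤ) {a b : (anTelecoreShape (Vmod := Vmod) (isArc := isArc) anTelJ).Vertex} {p q : Path a b}
    (h : (L.contactUniv).E p q) (h' : (L.contactUniv).E ((telShiftGraph k).mapPath p) ((telShiftGraph k).mapPath q))
    (x : (L.anTelecoreDiagram anTelJ (fun {a} j => L.telecoreFun a.1 j)).obj a) :
    HEq (((L.contactUniv).η h').app ((L.telShiftApp k a).obj x))
      ((L.telShiftApp k b).map (((L.contactUniv).η h).app x)) := by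
  let d : Decomp contactW p q := Classical.choice h
  have hη : (L.contactUniv).η h = d.η (L.contactOver) contactW L.contactFF :=
    univFamily_η_eq (L.contactOver) contactW L.contactFF h d
  have hη' : (L.contactUniv).η h' = (Decomp.telShift k d).η (L.contactOver) contactW L.contactFF :=
    univFamily_η_eq (L.contactOver) contactW L.contactFF h' (Decomp.telShift k d)
  rw [hη, hη', Decomp.η, Decomp.η]
  erw [NatTrans.comp_app, NatTrans.comp_app, NatTrans.comp_app, NatTrans.comp_app, eqToHom_app, eqToHom_app,
    eqToHom_app, eqToHom_app, Functor.whiskerRight_app, Functor.whiskerRight_app, Functor.map_comp, Functor.map_comp,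
    eqToHom_map, eqToHom_map]
  refine (eqToHom_comp_heq_iff _ _ _).2 ((heq_eqToHom_comp_iff _ _ _).2 ?_)
  refine (comp_eqToHom_heq_iff _ _ _).2 ((heq_comp_eqToHom_iff _ _ _).2 ?_)
  -- the whiskered lifts
  have hL := L.telShift_lift_app_heq k d.mem (contactW_shift k d.mem) d.p d.q x
  refine (functor_map_heq ((L.anTelecoreDiagram anTelJ (fun {a} j => L.telecoreFun a.1 j)).pathFunctor
      ((telShiftGraph k).mapPath d.s)) (L.telShift_pathFunctor_obj k d.p x) (L.telShift_pathFunctor_obj k d.q x) hL).trans ?_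
  exact Functor.hcongr_hom (L.telShift_pathComm k d.s) _

end LogFrobeniusSetting

end Literature.AnabelianGeometry.AbsoluteAnabelian
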